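import Mathlib
import Summits.PneNP.PneNP.Theses.AeaCutRectangles
import Summits.PneNP.PneNP.Theorems.AeaCutRectanglesDutyRectangles

/-!
# FoolingMeasure — round-2 ideation, seat 2, generation 6: semantic (trace) rectangles, the Hajós tail,
# the boundary-expansion repair, and the pigeonhole core of cheap seam covering

Companion file of the crux idea cards `hajos-tail-trace-rectangles`, `closure-criterion-lr-cliques` and
`rank-fragility` (crux item stmt-PneNP-19727, route AeaCutRectangles).  Everything here is about the uniform measures
`μ_t` on normal `t`-systems of `StarsAndSeams.lean` / `NormalCycleSystems.lean`; nothing here moves P ≠ NP.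

1. `semanticRect_not_colorable` (PROVED): for ANY set `T` of colourings, {α : every proper colouring of α lies in T} ×
   {β : no proper colouring of β lies in T} is a rectangle inside NON-3-COL.  With `T` depending only on a small set
   `D ⊆ B` of boundary vertices this is the TRACE rectangle: members whose Bob boundary `B ∖ interior` has ≤ d vertices
   are covered by ≤ n^d · 2^{3^d} rectangles, so an X1 measure must give them total mass ≤ n^d 2^{3^d} · 2^{-(n/2)log n - Cn}.
2. `BoundaryExpanding`, `UniformRectBoundBE`: the repaired X1 clause for `μ_t` — the HAJÓS TAIL (2-sums of a path-normal
   system and a normal system, which are again normal and rigid; explicit instance n = 28, t = 2 in the card's evidence)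
   has density 2^{-O(tn)} ≫ n^{-n/2} and boundary {e, ℓ}, so `UniformRectBound t ε δ` / `StarExtremality t` /
   `SeamCliqueBound t ε δ` of `StarsAndSeams.lean` are false AS TYPED for fixed t ≥ 3 unless the support forbids sparse
   boundaries outright (`HajosTailDense → ¬ UniformRectBound`, typed as `HajosTailKills`).
3. `pigeonhole_exit` (PROVED) and `orbit_exit` (PROVED): the combinatorial core of the L/R and equal-link constructions — if Bob's inside edges of every member form
   an injection of a fixed class `L ⊆ B` into a fixed class `R ⊆ B`, then every prefix set holding more `L`- than
   `R`-vertices is exited by one of them; by the closure criterion (card) this makes the whole L/R family a COV-clique of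
   relative size 2^{-O(tn)}: seam covering is cheap in every variant, and `uniformRectBound_of_seamCliqueBound` is vacuous.
-/

set_option linter.dupNamespace false

namespace Summit.PneNP.PneNP.Cruxes.FoolingMeasure.IdeasR2g6s2

open Finset
open Summit.PneNP.PneNP.Theorems.AeaCutRectanglesDutyRectangles (aliceSide bobSide mem_aliceSide mem_bobSide
  aliceSide_union_bobSide)

/-- 3-colourability of the graph spanned by an edge set over `Fin n` (as in the route file and `StarsAndSeams.lean`). -/
abbrev Col3 {n : ℕ} (G : Finset (Sym2 (Fin n))) : Prop :=
  (SimpleGraph.fromEdgeSet (G : Set (Sym2 (Fin n)))).Colorable 3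

/-! ## 0. Vocabulary restated verbatim from `Cruxes/FoolingMeasure/StarsAndSeams.lean` (namespace `…IdeasR2g5s2`;
crux workfiles are not importable modules on the farm, so the handful of definitions used below are repeated with the
same text: `interior`, `Rulers`, `succ`, `IsNormal`, `edges`, `Supp`, `ValidRect`, `Captured`, `InteriorHalfDense`,
`UniformRectBound`). -/

section vocabulary

variable {n : ℕ}

open Classical in
/-- fully interior Bob vertices of `G` at `B` (all `G`-neighbours in `B`). -/
noncomputable def interior (B : Finset (Fin n)) (G : Finset (Sym2 (Fin n))) : Finset (Fin n) :=
  B.filter fun v => ∀ e ∈ G, v ∈ e → ∀ w ∈ e, w ∈ B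

/-- `t` rulers (position maps of `t` Hamiltonian cycles) on `3q+1` labelled vertices. -/
abbrev Rulers (q t : ℕ) := Fin t → Equiv.Perm (Fin (3 * q + 1))

variable {q t : ℕ}

def succ (P : Rulers q t) (k : Fin t) (v : Fin (3 * q + 1)) : Fin (3 * q + 1) :=
  (P k).symm (P k v + 1)

def IsNormal (P : Rulers q t) : Prop :=
  ∀ i k : Fin t, i ≠ k → ∀ v, ((P i (succ P k v) - P i v).val) % 3 = 2

def edges (P : Rulers q t) : Finset (Sym2 (Fin (3 * q + 1))) :=
  univ.biUnion fun k => univ.image fun v => s(v, succ P k v)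

open Classical in
noncomputable def Supp (q t : ℕ) : Finset (Rulers q t) :=
  univ.filter fun P => IsNormal P ∧ ¬ Col3 (edges P)

def ValidRect {n : ℕ} (B : Finset (Fin n)) (𝓐 𝓑 : Finset (Finset (Sym2 (Fin n)))) : Prop :=
  (∀ α ∈ 𝓐, ∀ e ∈ α, ¬ e.IsDiag ∧ ∃ v ∈ e, v ∉ B) ∧ (∀ β ∈ 𝓑, ∀ e ∈ β, ¬ e.IsDiag ∧ ∀ v ∈ e, v ∈ B) ∧
    ∀ α ∈ 𝓐, ∀ β ∈ 𝓑, ¬ Col3 (α ∪ β)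

open Classical in
noncomputable def Captured (q t : ℕ) (B : Finset (Fin (3 * q + 1)))
    (𝓐 𝓑 : Finset (Finset (Sym2 (Fin (3 * q + 1))))) : Finset (Rulers q t) :=
  (Supp q t).filter fun P => aliceSide B (edges P) ∈ 𝓐 ∧ bobSide B (edges P) ∈ 𝓑

def InteriorHalfDense (ε δ : ℝ) (P : Rulers q t) : Prop :=
  ∀ B : Finset (Fin (3 * q + 1)),
    (1 / 2 - δ) * (3 * q + 1 : ℝ) ≤ B.card → (B.card : ℝ) ≤ (1 / 2 + δ) * (3 * q + 1 : ℝ) →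
      (1 / 2 + ε) * (3 * q + 1 : ℝ) ≤ ((bobSide B (edges P)).card : ℝ) - (interior B (edges P)).card

open Classical in
noncomputable def UniformRectBound (t : ℕ) (ε δ : ℝ) : Prop :=
  ∀ C : ℕ, ∃ q₀ : ℕ, ∀ q ≥ q₀, ∀ (B : Finset (Fin (3 * q + 1))) (𝓐 𝓑 : Finset (Finset (Sym2 (Fin (3 * q + 1))))),
    (1 / 2 - δ) * (3 * q + 1 : ℝ) ≤ B.card → (B.card : ℝ) ≤ (1 / 2 + δ) * (3 * q + 1 : ℝ) → ValidRect B 𝓐 𝓑 →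
      ((Captured q t B 𝓐 𝓑 ∩ (Supp q t).filter fun P => InteriorHalfDense ε δ P).card : ℝ) ≤
        (2 : ℝ) ^ (-((3 * q + 1 : ℝ) / 2 * Real.logb 2 (3 * q + 1)) - C * (3 * q + 1)) *
          ((Supp q t).filter fun P => InteriorHalfDense ε δ P).card

end vocabulary

section semantic

variable {n : ℕ}

/-- `c` is a proper colouring of the edge set `S`. -/
def ProperOn (S : Finset (Sym2 (Fin n))) (c : Fin n → Fin 3) : Prop :=
  ∀ u v, s(u, v) ∈ S → u ≠ v → c u ≠ c v

theorem properOn_of_coloring (S : Finset (Sym2 (Fin n)))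
    (C : (SimpleGraph.fromEdgeSet (S : Set (Sym2 (Fin n)))).Coloring (Fin 3)) : ProperOn S C := by
  intro u v huv hne
  exact C.valid ((SimpleGraph.fromEdgeSet_adj _).mpr ⟨Finset.mem_coe.mpr huv, hne⟩)

theorem properOn_mono {S S' : Finset (Sym2 (Fin n))} (h : S ⊆ S') {c : Fin n → Fin 3} (hc : ProperOn S' c) :
    ProperOn S c :=
  fun u v huv hne => hc u v (h huv) hne

/-- **Semantic (trace) rectangles are inside NON-3-COL.**  For any set `T` of colourings: if every proper colouring
of `α` lies in `T` and no proper colouring of `β` lies in `T`, then `α ∪ β` is not 3-colourable.  (R5's duty; with `T`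
determined by the trace on `D ⊆ B`, `|D| ≤ d`, only `n^d · 2^{3^d}` such rectangles exist.) -/
theorem semanticRect_not_colorable (T : Set (Fin n → Fin 3)) (α β : Finset (Sym2 (Fin n)))
    (hα : ∀ c, ProperOn α c → c ∈ T) (hβ : ∀ c, ProperOn β c → c ∉ T) : ¬ Col3 (α ∪ β) := by
  rintro ⟨C⟩
  have hC : ProperOn (α ∪ β) C := properOn_of_coloring _ C
  exact hβ C (properOn_mono subset_union_right hC) (hα C (properOn_mono subset_union_left hC))

/-- capture: a non-3-colourable `G` has no colouring proper on both of its sides at `B`; hence if its Alice side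
forces `T` (every proper colouring of `aliceSide B G` lies in `T`), its Bob side is automatically a `T`-column, and `G`
lies in the semantic rectangle indexed by `T`. -/
theorem no_common_proper_colouring (B : Finset (Fin n)) (G : Finset (Sym2 (Fin n))) (hG : ¬ Col3 G) :
    ∀ c, ProperOn (bobSide B G) c → ProperOn (aliceSide B G) c → False := by
  intro c hb ha
  apply hG
  classical
  refine ⟨SimpleGraph.Coloring.mk c ?_⟩
  intro u v huv
  rcases (SimpleGraph.fromEdgeSet_adj _).mp huv with ⟨he, hne⟩
  have he' : s(u, v) ∈ aliceSide B G ∪ bobSide B G := by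
    rw [aliceSide_union_bobSide]; exact Finset.mem_coe.mp he
  rcases Finset.mem_union.mp he' with h | h
  · exact ha u v h hne
  · exact hb u v h hne

end semantic

section repair

variable {q t : ℕ}

/-- BOUNDARY EXPANSION of one system: at every near-balanced cut at least `κ·n` Bob vertices have a neighbour on
Alice's side (`B ∖ interior`).  The Hajós tail (2-vertex boundaries, density `2^{-O(tn)}`) shows this clause is
NECESSARY for any X1 statement about `μ_t`; typical normal systems have `|B ∖ interior| ≥ (1 - 4^{-t}) |B|`. -/
def BoundaryExpanding (κ δ : ℝ) (P : Rulers q t) : Prop :=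
  ∀ B : Finset (Fin (3 * q + 1)),
    (1 / 2 - δ) * (3 * q + 1 : ℝ) ≤ B.card → (B.card : ℝ) ≤ (1 / 2 + δ) * (3 * q + 1 : ℝ) →
      κ * (3 * q + 1 : ℝ) ≤ (B.card : ℝ) - (interior B (edges P)).card

open Classical in
/-- the good part of the support after the g6 repair: rigid, normal, interior-half-dense AND boundary-expanding. -/
noncomputable def SuppBE (q t : ℕ) (ε δ κ : ℝ) : Finset (Rulers q t) :=
  (Supp q t).filter fun P => InteriorHalfDense ε δ P ∧ BoundaryExpanding κ δ P

open Classical in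
/-- **Repaired X1 clause for the conditioned uniform measure** (replaces `UniformRectBound t ε δ`, which the Hajós tail
refutes as typed for `t ≥ 3`): the uniform measure on `SuppBE` gives every valid near-balanced cut rectangle mass
`≤ 2^{-(n/2)·log₂ n − C n}`, eventually in `q`, for every `C`. -/
noncomputable def UniformRectBoundBE (t : ℕ) (ε δ κ : ℝ) : Prop :=
  ∀ C : ℕ, ∃ q₀ : ℕ, ∀ q ≥ q₀, ∀ (B : Finset (Fin (3 * q + 1))) (𝓐 𝓑 : Finset (Finset (Sym2 (Fin (3 * q + 1))))),
    (1 / 2 - δ) * (3 * q + 1 : ℝ) ≤ B.card → (B.card : ℝ) ≤ (1 / 2 + δ) * (3 * q + 1 : ℝ) → ValidRect B 𝓐 𝓑 →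
      ((Captured q t B 𝓐 𝓑 ∩ SuppBE q t ε δ κ).card : ℝ) ≤
        (2 : ℝ) ^ (-((3 * q + 1 : ℝ) / 2 * Real.logb 2 (3 * q + 1)) - C * (3 * q + 1)) * (SuppBE q t ε δ κ).card

open Classical in
/-- THE HAJÓS TAIL IS DENSE (heuristic density `2^{-(1+o(1)) t n}`; explicit member at `n = 28, t = 2` in the card):
for some `κ₀` and all large `q` there is a near-balanced cut `B` such that at least a `2^{-κ₀ n}` fraction of the
interior-half-dense support has Bob boundary of size ≤ 2 at `B`. -/
def HajosTailDense (t : ℕ) (ε δ : ℝ) : Prop :=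
  ∃ κ₀ q₀ : ℕ, ∀ q ≥ q₀, ∃ B : Finset (Fin (3 * q + 1)),
    (1 / 2 - δ) * (3 * q + 1 : ℝ) ≤ B.card ∧ (B.card : ℝ) ≤ (1 / 2 + δ) * (3 * q + 1 : ℝ) ∧
      ((Supp q t).filter fun P => InteriorHalfDense ε δ P).card ≤
        2 ^ (κ₀ * (3 * q + 1)) *
          ((Supp q t).filter fun P => InteriorHalfDense ε δ P ∧ B.card ≤ (interior B (edges P)).card + 2).card

/-- **Claim of the card (to be proved by the trace-rectangle count `n² · 2⁹`):** a dense Hajós tail refutes the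
unrepaired clause.  -/
def HajosTailKills (t : ℕ) : Prop :=
  ∀ ε δ : ℝ, 0 < δ → HajosTailDense t ε δ → ¬ UniformRectBound t ε δ

end repair

section pigeonhole

variable {V : Type*} [DecidableEq V]

/-- **Pigeonhole core of the L/R covering cliques.**  `g` sends the class `L` injectively into the class `R`
(Bob's inside ruler-`k` edges of ONE member: each run is an `L`-vertex followed by its `R`-partner).  If a vertex set
`S` (a prefix set of ANOTHER member's ruler order, cut inside a run) holds more `L`-vertices than `R`-vertices
available as partners, then some `L`-vertex of `S` has its partner outside `S` — an arc of the cover digraph exits `S`,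
so by the closure criterion the seam is covered.  No coordination between the two members beyond the classes `L, R`
(and, in the application, the shared wrap pair) is used: the family is a COV-clique of relative size `2^{-O(tn)}`. -/
theorem pigeonhole_exit (L R S R₀ : Finset V) (g : V → V) (hg : Set.InjOn g L) (_hLR : ∀ x ∈ L, g x ∈ R)
    (hR₀ : ∀ x ∈ S ∩ L, g x ∈ S → g x ∈ R₀) (hcard : (S ∩ R₀).card < (S ∩ L).card) :
    ∃ x ∈ S ∩ L, g x ∉ S := by
  by_contra! h
  have hmaps : ∀ x ∈ S ∩ L, g x ∈ S ∩ R₀ := by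
    intro x hx
    exact Finset.mem_inter.mpr ⟨h x hx, hR₀ x hx (h x hx)⟩
  have hinj : Set.InjOn g (S ∩ L : Finset V) := by
    intro x hx y hy hxy
    exact hg (Finset.mem_inter.mp (Finset.mem_coe.mp hx)).2 (Finset.mem_inter.mp (Finset.mem_coe.mp hy)).2 hxy
  have := Finset.card_le_card_of_injOn g hmaps hinj
  omega

end pigeonhole

/-! ## Orbit exit: the exit step of the equal-link covering theorem
If the hybrid's ruler-`k` successor map `σ` carries the first vertex `a = u'_k` of a seam prefix `S` to a vertex
outside `S` after `m` steps (in an equal-link 2-factor hybrid: to `u_k`, the last vertex of `P`'s order), then some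
vertex of `S` has its `σ`-successor outside `S`, i.e. an inside ruler-`k` edge of Bob's side exits the prefix and the
seam colouring of `S` is improper on it (card `closure-criterion-lr-cliques`, EQUAL-LINK THEOREM). -/
section orbit

variable {V : Type*}

theorem orbit_exit (σ : V → V) (S : Set V) {a : V} (ha : a ∈ S) (m : ℕ)
    (hm : σ^[m] a ∉ S) : ∃ x ∈ S, σ x ∉ S := by
  induction m generalizing a with
  | zero => exact absurd ha (by simpa using hm)
  | succ m ih =>
    by_cases h : σ a ∈ S
    · exact ih h (by simpa only [Function.iterate_succ_apply] using hm)
    · exact ⟨a, ha, h⟩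

/-- Finset form used with `P`'s seam prefixes. -/
theorem orbit_exit_finset [DecidableEq V] (σ : V → V) (S : Finset V) {a : V} (ha : a ∈ S) (m : ℕ)
    (hm : σ^[m] a ∉ S) : ∃ x ∈ S, σ x ∉ S := by
  have := orbit_exit σ (S : Set V) (a := a) (by simpa using ha) m (by simpa using hm)
  simpa using this

end orbit

end Summit.PneNP.PneNP.Cruxes.FoolingMeasure.IdeasR2g6s2
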